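import Literature.Combinatorics.Sahi2008.CumulationCone
import Literature.Combinatorics.Sahi2008.UniformSquareAllOrders
import HarnessLib

/-!
# Lieb–Sahi (2022), Theorem 3.5: the `n`-function inequality for rectangles, discrete form

Topic `Literature/Combinatorics/Sahi2008` (companions: `Functional.lean` — `sahiE`, `ex`; `Indicators.lean` —
`setInd`; `CumulationCone.lean` — Sahi's Theorem 2 for product measures, `sahi2008_thm2_indicator`,
`finsetProdWeight`; `UniformSquareAllOrders.lean` — the moment principle `sahiE_congr_of_moments`).

## Source (read 2026-08-19 from the materialised arXiv text, corpus `paper:arxiv-2107.09838`, pp. 7–8)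

E. H. Lieb, S. Sahi, *On the extension of the FKG inequality to `n` functions*, J. Math. Phys. **63** (2022)
043301 = arXiv:2107.09838 [LiebSahi2021], §3.3 "Proof of the `n` function inequality for rectangles in any
dimension":

> "By a rectangle in dimension `k`, or a `k`-rectangle, we mean a subset of `[0,1]^k` of the form
> `[0,r_1] × ⋯ × [0,r_k]`, `0 ≤ r_1,…,r_k ≤ 1`.
> **THEOREM 3.5.** If `f^i` are characteristic functions of `k`-rectangles then `E_n(f^1,…,f^n) ≥ 0`."

(`[0,1]^k` with Lebesgue measure; the printed proof is an induction on `k` and `n` through the cycle partial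
sums `P_c` of Prop. 3.4.)

## What is formalised (discrete form, and how it is proved)

The grid `κ → Fin (M+1)` (a product of finite chains `{0,…,M}` indexed by a finite type `κ`, `|κ| = k`)
with a PRODUCT probability weight `w(x) = Π_j v_j(x_j)` of positive marginals `v_j` (the uniform weight — the
discretisation of Lebesgue measure, cf. [LiebSahi2021, Lemma 2.3] — is the case `v_j ≡ 1/(M+1)`), and the
boxes `B_r = {x : x_j ≤ r_j ∀ j}` (the rectangles `[0,r_1] × ⋯ × [0,r_k]` of the grid):
**`sahiE_box_nonneg`**: `E_n(χ_{B_{r^1}},…,χ_{B_{r^n}}) ≥ 0` for every `n` and all boxes;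
**`liebSahi_thm35`**: the same for the uniform weight (Theorem 3.5 with `[0,1]^k` replaced by the grid).

PROOF ROUTE (a documented deviation from the printed induction, which uses the cycle expansion
[LiebSahi2021, Prop. 3.4] not available for the tree's recursively defined `E_n`): by
`sahiE_congr_of_moments`, `E_n` of a family depends only on its joint moments.  The joint moments of boxes
under a product weight are products of marginal distribution functions,
`E(Π_{i∈S} χ_{B_{r^i}}) = w(B_{min_S r^i}) = Π_j V_j(min_{i∈S} r^i_j)` (`ex_prod_setInd_box`), and these are
ALSO the joint moments of the principal up-sets `{T ⊇ U(r^i)}`, `U(r) = {(j,a) : a ≥ r_j}`, of the Boolean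
lattice `2^{κ × [M]}` under the product Bernoulli weight with `m_{(j,a)} = V_j(a)/V_j(a+1)` (telescoping,
`sum_finsetProdWeight_mul_supInd`, `prod_coin_upLevels`) — to which Sahi's Theorem 2
[Sahi2008, Thm. 2], a tree theorem (`sahi2008_thm2_indicator`), applies.  (This is the standard "maximum of
independent coins" representation of a chain-valued variable; rectangles pull back to principal
down-sets, i.e. to Sahi's cumulation cone after complementation.)  So Theorem 3.5 is exhibited here as a
COROLLARY of [Sahi2008, Thm. 2]; Lieb–Sahi give an independent proof.

Everything here is PROVED; no named facts; axioms standard.  [LiebSahi2021, Cor. 3.6] (functions whose level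
sets are rectangles) is the layer cake over this theorem and is not separately stated.
-/

noncomputable section

namespace Literature.Combinatorics.Sahi2008

open Finset Function

namespace LiebSahiBox

variable {κ : Type*} [Fintype κ] [DecidableEq κ] {M : ℕ}

/-! ### The grid of chains, product weights, boxes, distribution functions -/

/-- The product weight `w(x) = Π_j v_j(x_j)` on the grid `κ → Fin (M+1)` (for `v_j ≡ 1/(M+1)` the uniform
weight, the discretised Lebesgue measure on `[0,1]^k`). [cite: LiebSahi2021, §2 (Q_k with Lebesgue measure) and Lemma 2.3] -/
def chainProdWeight (v : κ → Fin (M + 1) → ℝ) (x : κ → Fin (M + 1)) : ℝ := ∏ j, v j (x j)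

/-- The box (rectangle with a corner at the origin) `B_r = {x : x_j ≤ r_j for all j}` of the grid.
[cite: LiebSahi2021, §3.3 (k-rectangles [0,r_1]×⋯×[0,r_k])] -/
def box (r : κ → Fin (M + 1)) : Finset (κ → Fin (M + 1)) := univ.filter fun x => ∀ j, x j ≤ r j

/-- The marginal distribution function `V_j(a) = Σ_{b ≤ a} v_j(b)` (`a ∈ ℕ`). [cite: LiebSahi2021, §3.3 (eq. (3.9): E(f^{i_1}⋯f^{i_p}) = a_l E(g⋯))] -/
def cdf (v : κ → Fin (M + 1) → ℝ) (j : κ) (a : ℕ) : ℝ :=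
  ∑ b ∈ (univ : Finset (Fin (M + 1))).filter (fun b : Fin (M + 1) => b.val ≤ a), v j b

/-- Membership in a box. [cite: LiebSahi2021, §3.3] -/
theorem mem_box {r x : κ → Fin (M + 1)} : x ∈ box r ↔ ∀ j, x j ≤ r j := by
  simp [box]

/-- `B_⊤` is the whole grid. [folklore] -/
private theorem box_top : box (⊤ : κ → Fin (M + 1)) = univ := by
  ext x
  simp only [mem_box, mem_univ, iff_true]
  exact fun j => le_top

/-- `B_r ∩ B_{r'} = B_{r ⊓ r'}`. [cite: LiebSahi2021, §3.3 (eq. (3.9))] -/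
theorem box_inf (r r' : κ → Fin (M + 1)) : box (r ⊓ r') = box r ∩ box r' := by
  ext x
  simp only [mem_box, mem_inter, Pi.inf_apply, le_inf_iff]
  exact ⟨fun h => ⟨fun j => (h j).1, fun j => (h j).2⟩, fun h j => ⟨h.1 j, h.2 j⟩⟩

/-- `χ_{Q} = 1` (plumbing). [folklore] -/
private theorem setInd_univ_eq_one' {β : Type*} [Fintype β] [DecidableEq β] : setInd (univ : Finset β) = 1 := by
  funext x
  simp [setInd_apply]

/-- A product of box indicators is the indicator of the box of the entrywise minimum.
[cite: LiebSahi2021, §3.3 (eq. (3.9))] -/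
theorem prod_setInd_box {σ : Type*} [DecidableEq σ] (S : Finset σ) (r : σ → κ → Fin (M + 1)) :
    ∏ i ∈ S, setInd (box (r i)) = setInd (box (S.inf r)) := by
  induction S using Finset.induction_on with
  | empty => rw [prod_empty, Finset.inf_empty, box_top, setInd_univ_eq_one']
  | insert i S hi ih => rw [prod_insert hi, ih, setInd_mul, ← box_inf, Finset.inf_insert]

omit [Fintype κ] [DecidableEq κ] in
/-- The distribution function at the top level is the total mass `1`. [cite: LiebSahi2021, §3.3] -/
theorem cdf_top {v : κ → Fin (M + 1) → ℝ} (hv1 : ∀ j, ∑ a, v j a = 1) (j : κ) : cdf v j M = 1 := by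
  unfold cdf
  rw [← hv1 j]
  refine sum_congr ?_ fun _ _ => rfl
  ext b
  simp only [mem_filter, mem_univ, true_and, iff_true]
  exact Nat.le_of_lt_succ b.isLt

omit [Fintype κ] [DecidableEq κ] in
/-- `V_j` is nonneg for nonneg marginals. [folklore] -/
private theorem cdf_nonneg {v : κ → Fin (M + 1) → ℝ} (hv0 : ∀ j a, 0 < v j a) (j : κ) (a : ℕ) :
    0 ≤ cdf v j a :=
  sum_nonneg fun b _ => (hv0 j b).le

omit [Fintype κ] [DecidableEq κ] in
/-- `V_j(a) > 0` (it contains the term `b = 0`). [folklore] -/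
private theorem cdf_pos {v : κ → Fin (M + 1) → ℝ} (hv0 : ∀ j a, 0 < v j a) (j : κ) (a : ℕ) :
    0 < cdf v j a := by
  unfold cdf
  have h0 : (0 : Fin (M + 1)) ∈ univ.filter (fun b : Fin (M + 1) => (b : ℕ) ≤ a) := by simp
  exact lt_of_lt_of_le (hv0 j 0) (single_le_sum (fun b _ => (hv0 j b).le) h0)

omit [Fintype κ] [DecidableEq κ] in
/-- `V_j` is monotone. [folklore] -/
private theorem cdf_mono {v : κ → Fin (M + 1) → ℝ} (hv0 : ∀ j a, 0 < v j a) (j : κ) {a a' : ℕ}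
    (h : a ≤ a') : cdf v j a ≤ cdf v j a' := by
  unfold cdf
  refine sum_le_sum_of_subset_of_nonneg ?_ fun b _ _ => (hv0 j b).le
  intro b hb
  rw [mem_filter] at hb ⊢
  exact ⟨hb.1, hb.2.trans h⟩

/-- **The mass of a box under a product weight is the product of the marginal distribution functions**:
`w(B_r) = Π_j V_j(r_j)` (Lieb–Sahi's (3.9): `E(f^{i_1}⋯f^{i_p}) = a_l E(g^{i_1}⋯g^{i_p})`, iterated over the
coordinates). [cite: LiebSahi2021, §3.3, eq. (3.9)] -/
theorem ex_setInd_box (v : κ → Fin (M + 1) → ℝ) (r : κ → Fin (M + 1)) :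
    ex (chainProdWeight v) (setInd (box r)) = ∏ j, cdf v j (r j) := by
  classical
  rw [ex_setInd]
  show ∑ x ∈ box r, chainProdWeight v x = _
  have hbox : box r = Fintype.piFinset fun j => univ.filter fun b : Fin (M + 1) => (b : ℕ) ≤ (r j : ℕ) := by
    ext x
    simp only [mem_box, Fintype.mem_piFinset, mem_filter, mem_univ, true_and, Fin.le_iff_val_le_val]
  rw [hbox]
  unfold chainProdWeight cdf
  rw [← prod_univ_sum]

/-- The joint moments of box indicators. [cite: LiebSahi2021, §3.3, eq. (3.9)] -/
theorem ex_prod_setInd_box (v : κ → Fin (M + 1) → ℝ) {σ : Type*} [DecidableEq σ] (S : Finset σ)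
    (r : σ → κ → Fin (M + 1)) :
    ex (chainProdWeight v) (∏ i ∈ S, setInd (box (r i))) = ∏ j, cdf v j ((S.inf r) j) := by
  rw [prod_setInd_box, ex_setInd_box]

/-! ### The cube side: principal up-sets of `2^{κ × [M]}` under a product Bernoulli weight -/

/-- The set of "levels above `r`": `U(r) = {(j,a) : a ≥ r_j}` (`a ∈ {0,…,M−1}` standing for the level `a+1`
of the `j`-th chain). [cite: Sahi2008, p. 210 (principal up-sets {T ⊇ S} generating 𝒞[X])] -/
def upLevels (r : κ → Fin (M + 1)) : Finset (κ × Fin M) := univ.filter fun p => (r p.1 : ℕ) ≤ (p.2 : ℕ)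

omit [DecidableEq κ] in
/-- `U(⊤) = ∅`. [folklore] -/
private theorem upLevels_top : upLevels (⊤ : κ → Fin (M + 1)) = ∅ := by
  ext ⟨j, a⟩
  simp only [upLevels, mem_filter, mem_univ, true_and, Finset.notMem_empty, iff_false, not_le]
  show (a : ℕ) < ((⊤ : κ → Fin (M + 1)) j : ℕ)
  rw [Pi.top_apply, Fin.top_eq_last, Fin.val_last]
  exact a.isLt

/-- `U(r ⊓ r') = U(r) ∪ U(r')`. [folklore] -/
private theorem upLevels_inf (r r' : κ → Fin (M + 1)) : upLevels (r ⊓ r') = upLevels r ∪ upLevels r' := by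
  ext ⟨j, a⟩
  simp only [upLevels, mem_filter, mem_univ, true_and, mem_union, Pi.inf_apply]
  rcases le_total (r j) (r' j) with h | h
  · rw [inf_eq_left.2 h]
    have h' : (r j : ℕ) ≤ (r' j : ℕ) := h
    exact ⟨fun hle => Or.inl hle, fun hle => hle.elim id fun hle' => h'.trans hle'⟩
  · rw [inf_eq_right.2 h]
    have h' : (r' j : ℕ) ≤ (r j : ℕ) := h
    exact ⟨fun hle => Or.inr hle, fun hle => hle.elim (fun hle' => h'.trans hle') id⟩

/-- The indicator of the principal up-set `{T : U ⊆ T}` of the Boolean lattice (Sahi's generator of `𝒞[X]`).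
[cite: Sahi2008, p. 210] -/
def supInd {X : Type*} [DecidableEq X] (U : Finset X) (T : Finset X) : ℝ := if U ⊆ T then 1 else 0

/-- A product of principal up-set indicators is the indicator of the principal up-set of the union.
[cite: Sahi2008, Lemma 11 (𝒞[X] is closed under products)] -/
theorem prod_supInd_upLevels {σ : Type*} [DecidableEq σ] (S : Finset σ) (r : σ → κ → Fin (M + 1)) :
    ∏ i ∈ S, supInd (upLevels (r i)) = supInd (upLevels (S.inf r)) := by
  classical
  induction S using Finset.induction_on with
  | empty =>
    funext T
    rw [prod_empty, Finset.inf_empty, upLevels_top]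
    simp [supInd]
  | insert i S hi ih =>
    funext T
    rw [prod_insert hi, ih, Finset.inf_insert, upLevels_inf]
    simp only [Pi.mul_apply, supInd]
    by_cases h1 : upLevels (r i) ⊆ T <;> by_cases h2 : upLevels (S.inf r) ⊆ T <;>
      simp [h1, h2, union_subset_iff]

/-- **The mass of a principal up-set under the product Bernoulli weight**: `Σ_T μ_m(T)·1_{U ⊆ T} = Π_{x∈U} m_x`.
[cite: Sahi2008, eq. (2) (p. 210) and the proof of Thm. 1 (p. 217: the weight of {T ⊇ S})] -/
theorem sum_finsetProdWeight_mul_supInd {X : Type*} [Fintype X] [DecidableEq X] (m : X → ℝ) (U : Finset X) :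
    ∑ T, finsetProdWeight m T * supInd U T = ∏ x ∈ U, m x := by
  have key := Fintype.prod_add (fun x => m x) (fun x => if x ∈ U then (0 : ℝ) else 1 - m x)
  have hl : ∏ x, (m x + (if x ∈ U then (0 : ℝ) else 1 - m x)) = ∏ x ∈ U, m x := by
    rw [← univ_inter U, ← prod_ite_mem univ U]
    refine prod_congr rfl fun x _ => ?_
    by_cases hx : x ∈ U <;> simp [hx]
  rw [hl] at key
  rw [key]
  refine sum_congr rfl fun T _ => ?_
  unfold supInd finsetProdWeight
  by_cases hU : U ⊆ T
  · rw [if_pos hU, mul_one]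
    have hsplit : ∏ x, (if x ∈ T then m x else 1 - m x) =
        (∏ x, if x ∈ T then m x else 1) * ∏ x, (if x ∈ T then 1 else 1 - m x) := by
      rw [← prod_mul_distrib]
      refine prod_congr rfl fun x _ => ?_
      by_cases hx : x ∈ T <;> simp [hx]
    have hT : ∏ x, (if x ∈ T then m x else 1) = ∏ a ∈ T, m a := by
      rw [prod_ite_mem univ T, univ_inter]
    have hTc : ∏ x, (if x ∈ T then (1 : ℝ) else 1 - m x) = ∏ a ∈ Tᶜ, (if a ∈ U then 0 else 1 - m a) := by
      rw [show (Tᶜ : Finset X) = univ.filter (fun x => x ∉ T) by ext; simp, prod_filter]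
      refine prod_congr rfl fun x _ => ?_
      by_cases hx : x ∈ T
      · simp [hx]
      · have hxU : x ∉ U := fun h => hx (hU h)
        simp [hx, hxU]
    rw [hsplit, hT, hTc]
  · rw [if_neg hU, mul_zero]
    obtain ⟨x, hxU, hxT⟩ := not_subset.1 hU
    have hxc : x ∈ (Tᶜ : Finset X) := mem_compl.2 hxT
    rw [← mul_prod_erase _ _ hxc, if_pos hxU]
    ring

/-- The coin probabilities `m_{(j,a)} = V_j(a)/V_j(a+1)` of the representation (plumbing). [folklore] -/
private def coin (v : κ → Fin (M + 1) → ℝ) (p : κ × Fin M) : ℝ := cdf v p.1 (p.2 : ℕ) / cdf v p.1 ((p.2 : ℕ) + 1)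

omit [Fintype κ] [DecidableEq κ] in
/-- `0 ≤ m ≤ 1`. [folklore] -/
private theorem coin_mem {v : κ → Fin (M + 1) → ℝ} (hv0 : ∀ j a, 0 < v j a) (p : κ × Fin M) :
    0 ≤ coin v p ∧ coin v p ≤ 1 := by
  unfold coin
  refine ⟨div_nonneg (cdf_nonneg hv0 _ _) (cdf_nonneg hv0 _ _), ?_⟩
  rw [div_le_one (cdf_pos hv0 _ _)]
  exact cdf_mono hv0 _ (Nat.le_succ _)

/-- Telescoping: `Π_{a=r}^{b−1} V(a)/V(a+1) · V(b) = V(r)`. [folklore] -/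
private theorem prod_Ico_telescope (V : ℕ → ℝ) (hV : ∀ a, V a ≠ 0) (r : ℕ) :
    ∀ b, r ≤ b → (∏ a ∈ Ico r b, V a / V (a + 1)) * V b = V r := by
  refine Nat.le_induction ?_ fun b hb ih => ?_
  · rw [Ico_self, prod_empty, one_mul]
  · rw [prod_Ico_succ_top hb, mul_assoc, div_mul_cancel₀ (V b) (hV (b + 1))]
    exact ih

omit [DecidableEq κ] in
/-- **The moments match**: `Π_{x ∈ U(r)} m_x = Π_j V_j(r_j)` (telescoping). [cite: LiebSahi2021, §3.3, eq. (3.9)] -/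
private theorem prod_coin_upLevels {v : κ → Fin (M + 1) → ℝ} (hv0 : ∀ j a, 0 < v j a) (hv1 : ∀ j, ∑ a, v j a = 1)
    (r : κ → Fin (M + 1)) : ∏ p ∈ upLevels r, coin v p = ∏ j, cdf v j (r j) := by
  unfold upLevels
  rw [prod_filter, Fintype.prod_prod_type]
  refine prod_congr rfl fun j _ => ?_
  -- per coordinate: `Π_{a ≥ r_j} V_j(a)/V_j(a+1) = V_j(r_j)/V_j(M) = V_j(r_j)`
  have h1 : ∏ a : Fin M, (if (r j : ℕ) ≤ (a : ℕ) then coin v (j, a) else 1) =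
      ∏ a ∈ Ico (r j : ℕ) M, cdf v j a / cdf v j (a + 1) := by
    have hg : ∏ a : Fin M, (if (r j : ℕ) ≤ (a : ℕ) then coin v (j, a) else 1) =
        ∏ a : Fin M, (fun k : ℕ => if (r j : ℕ) ≤ k then cdf v j k / cdf v j (k + 1) else 1) (a : ℕ) :=
      prod_congr rfl fun a _ => rfl
    rw [hg, Fin.prod_univ_eq_prod_range (fun k : ℕ => if (r j : ℕ) ≤ k then cdf v j k / cdf v j (k + 1) else 1) M,
      ← prod_filter]
    refine prod_congr ?_ fun _ _ => rfl
    ext a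
    simp only [mem_filter, mem_range, mem_Ico]
    tauto
  rw [h1]
  have h2 := prod_Ico_telescope (cdf v j) (fun a => (cdf_pos hv0 j a).ne') (r j : ℕ) M
    (Nat.le_of_lt_succ (r j).isLt)
  rw [cdf_top hv1, mul_one] at h2
  exact h2

/-! ### Theorem 3.5 -/

/-- **E_n of boxes under a product weight is nonnegative** (every `n`, every grid `κ → {0,…,M}`, every
product of positive marginals): a corollary of [Sahi2008, Thm. 2] through the moment principle — the boxes
have the joint moments of principal up-sets of `2^{κ×[M]}` under the product Bernoulli weight `m = V(a)/V(a+1)`.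
[cite: LiebSahi2021, Thm. 3.5; Sahi2008, Thm. 2 (p. 211)] -/
theorem sahiE_box_nonneg {v : κ → Fin (M + 1) → ℝ} (hv0 : ∀ j a, 0 < v j a) (hv1 : ∀ j, ∑ a, v j a = 1)
    (n : ℕ) (r : Fin n → κ → Fin (M + 1)) :
    0 ≤ sahiE (chainProdWeight v) n (fun i => setInd (box (r i))) := by
  classical
  have hmom : ∀ S : Finset (Fin n), S.Nonempty →
      ex (chainProdWeight v) (∏ i ∈ S, setInd (box (r i))) =
        ex (finsetProdWeight (coin v)) (∏ i ∈ S, supInd (upLevels (r i))) := by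
    intro S _
    rw [ex_prod_setInd_box, prod_supInd_upLevels, ex]
    show ∏ j, cdf v j ((S.inf r) j) = ∑ T, finsetProdWeight (coin v) T * supInd (upLevels (S.inf r)) T
    rw [sum_finsetProdWeight_mul_supInd, prod_coin_upLevels hv0 hv1]
  rw [sahiE_congr_of_moments (chainProdWeight v) (finsetProdWeight (coin v)) n _
    (fun i => supInd (upLevels (r i))) hmom]
  exact sahi2008_thm2_indicator (coin v) (fun p => (coin_mem hv0 p).1) (fun p => (coin_mem hv0 p).2)
    (fun i => upLevels (r i))

/-- The uniform probability weight on the grid `κ → {0,…,M}` (discretised Lebesgue measure on `[0,1]^k`).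
[cite: LiebSahi2021, §2 (Q_k with Lebesgue measure) and Lemma 2.3] -/
def uniformChain (κ : Type*) (M : ℕ) : κ → Fin (M + 1) → ℝ := fun _ _ => 1 / ((M : ℝ) + 1)

omit [DecidableEq κ] in
/-- The uniform weight on the grid is the product of the uniform marginals. [cite: LiebSahi2021, §2] -/
theorem chainProdWeight_uniform (x : κ → Fin (M + 1)) :
    chainProdWeight (uniformChain κ M) x = (1 / ((M : ℝ) + 1)) ^ Fintype.card κ := by
  unfold chainProdWeight uniformChain
  rw [prod_const, card_univ]

/-- **Lieb–Sahi's Theorem 3.5, discrete form**: under the uniform probability weight on the grid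
`{0,…,M}^k` (any finite index type `κ`, `|κ| = k`), `E_n(χ_{B^1},…,χ_{B^n}) ≥ 0` for every `n` and all boxes
`B^i = {x : x_j ≤ r^i_j ∀ j}` (the `k`-rectangles `[0,r_1]×⋯×[0,r_k]` of the grid).  The passage to Lebesgue
measure on `[0,1]^k` (an `L¹` limit as in their Lemma 2.3) is not formalised. [cite: LiebSahi2021, Thm. 3.5] -/
theorem liebSahi_thm35 (n : ℕ) (r : Fin n → κ → Fin (M + 1)) :
    0 ≤ sahiE (chainProdWeight (uniformChain κ M)) n (fun i => setInd (box (r i))) := by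
  refine sahiE_box_nonneg (fun j a => ?_) (fun j => ?_) n r
  · unfold uniformChain
    positivity
  · unfold uniformChain
    rw [sum_const, card_univ, Fintype.card_fin, nsmul_eq_mul, Nat.cast_succ]
    have : ((M : ℝ) + 1) ≠ 0 := by positivity
    field_simp

end LiebSahiBox

end Literature.Combinatorics.Sahi2008
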